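import Summits.ABC.ABC.Theses.RibetTakahashiSplit
import Summits.ABC.ABC.Theorems.RibetTakahashiSplitFewPrimeValuationProductDecomposition
import Summits.ABC.ABC.Theorems.RibetTakahashiSplitFewPrimeValuationProductSwitchingGlue
import HarnessLib

/-!
# Line `wall-split` for crux `FewPrimeValuationProduct` (stmt-ABC-1563) — DECOMPOSITION LINE (crux-strategist, wall-breaker seat)

Crux (route `RibetTakahashiSplit`, r4): for `W/ℚ` elliptic, semistable away from `2`, with `≤ 3` odd multiplicative
primes, `T(W) := ∏_{p ∥ N} c_p ≤ C_ε N^ε` (`c_p := ord_p Δ_min`).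

This skeleton carries NO lever claim. It is the WALL SPLIT of the crux-strategist census
(`Cruxes/FewPrimeValuationProduct/STRATEGY-CENSUS.md` §4 D6): three registered stubs, one per named wall of the crux
programme, each crux-NECESSARY (so the split is an equivalence) and each strictly weaker than the crux:

* `stub_subexpAbcFourPrimes` — W3: sub-exponential abc on triples with `≤ 4` prime factors (= crux `FewPrimeHardCore`,
  stmt-ABC-15197, modulo the LFL input; landed both ways in `…Decomposition.lean`). Staffed at 15197 — NOT here.
* `stub_pairHalfResidual` — W1: the pair half `c_p c_q ≤ C_ε N^ε gcd(c_p,c_q)²` on the curves of the class WITHOUT a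
  numerical Frey shadow. Its only known lever is the two-prime JL mean-square lower bound (= r2's lever, dead in lines
  `switching-triangle` / `hasse-pinning-fixed-level`); census §2 T6–T8 shows every other proposed lever relocates onto it.
* `stub_depthResidual` — W2: the depth `gcd_{p ∥ N} c_p ≤ C_ε N^ε` on the same shadow-free class (semistable sub-case =
  Mestre–Oesterlé; open content = balanced residual depth = least distinguishing prime / polynomial Frey–Mazur for the ten
  curves of 2-power conductor; first mechanism `Ideas/level-raising-depth.md`).

Composition (sorry-free): `wallSplit_valProd_le_of_bounds` (the simplex bound `∏ c ≤ X^{12} G^4` of line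
`switching-triangle`, made RELATIVE to a sub-class in BOTH hypotheses), `valProd_noShadow_of_pairResidual_of_depthResidual`
(stubs 2 ∧ 3 ⟹ the residual `NonFreyResidual`), `FewPrimeValuationProduct_of_stubs` (stub 1 → stub 2 → stub 3 → crux, via
`crux_of_frey_of_residual ∘ freyFewPrime_of_subexpFour`), `FewPrimeValuationProduct_of` (the crux BY NAME from the three
stubs); necessity of each stub and `fewPrimeValuationProduct_iff_stubs`. The same theorems, under
`Summit.ABC.ABC.Theorems.FewPrimeValuationProduct`, are attached to stmt-ABC-1563 as evidence `WallSplit.lean` for a PROVER to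
land as `Theorems/RibetTakahashiSplitFewPrimeValuationProductWallSplit.lean` (planners are refused Theorems writes).

WHAT A LEAD CAN LAND HERE BEFORE HITTING THE WALLS (line card `Lines/wall-split.md`): (1) the Theorems copy of this file's
sorry-free part; (2) the routine lemma "twisted Frey shape ⟹ numerical shadow" and the port of `stub_depthResidual_of_hasse`
(p142354) / `smallPrimeDepth_of_facts` (p147274) / `stub_depthSemistable_of_mestreOesterle` (p100716) to stub 3's class;
(3) the GRH-conditional closure of stub 3 on the one-odd-prime face (least distinguishing prime `≪ (log N)²`); then
`promote-stub` for stubs 2 and 3 (the formal `route edit --split` with `children.json`, evidence on stmt-ABC-1563, is deferred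
by the final-cycle rule).
-/

-- `Summit.<Summit>.<Problem>`: for the single-conjunct summit `ABC` the duplicate `ABC.ABC` is mandated.
set_option linter.dupNamespace false

noncomputable section

namespace Summit.ABC.ABC.Cruxes.FewPrimeValuationProduct.WallSplit

open scoped BigOperators
open Finset
open Literature.NumberTheory.DiophantineGeometry
open Summit.ABC.ABC.Theorems.FewPrimeValuationProduct (crux_of_frey_of_residual freyFewPrime_of_subexpFour
  subexpFour_of_fewPrimeValuationProduct switching_simplex_bound switching_card_filter_le_four)

/-! ## Registered stubs (signatures fully qualified; no local definitions) -/

/-- **stub 1 — W3: sub-exponential abc on four-prime triples** (`SubexpAbcFourPrimes`): `log c ≤ κ_ε rad(abc)^ε`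
whenever `ω(abc) ≤ 4`. = crux `FewPrimeHardCore` (stmt-ABC-15197) ∧ the LFL input (landed:
`freyFewPrime_of_lfl_of_hardCore`, `subexpFour_of_freyFewPrime`; conversely `hardCore_of_freyFewPrime ∘
freyFewPrime_of_subexpFour`). Crux-necessary (`subexpFour_of_fewPrimeValuationProduct`). Size: XXL (abc-strength in the
Pillai regime) — staffed at 15197, not in this line. -/
theorem stub_subexpAbcFourPrimes :
    ∀ ε : ℝ, 0 < ε → ∃ κ : ℝ, ∀ a b c : ℕ, Literature.NumberTheory.DiophantineGeometry.IsABCTriple a b c → (a * b * c).primeFactors.card ≤ 4 → Real.log c ≤ κ * (Literature.NumberTheory.DiophantineGeometry.rad a b c : ℝ) ^ ε := by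
  sorry

/-- **stub 2 — W1: the pair half on the shadow-free class** (`FewPrimePairHalfResidual`): for `W` semistable away
from `2`, `≤ 3` odd multiplicative primes, NO numerical Frey shadow, and distinct multiplicative `p ≠ q`:
`c_p c_q ≤ C_ε N^ε gcd(c_p,c_q)²`. Crux-necessary (`pairResidual_of_fewPrimeValuationProduct` below). Known lever:
two-prime RT–Pasten package (landed p99190) × two-prime JL mean-square lower bound (Pasten Conj. 1.14 at levels
`(pq, N/pq)`; r2's lever) — no other lever known (census §2). Size: XXL. -/
theorem stub_pairHalfResidual :
    ∀ ε : ℝ, 0 < ε → ∃ C : ℝ, ∀ (W : WeierstrassCurve ℚ) [W.IsElliptic], (∀ p : ℕ, p.Prime → p ≠ 2 → ¬ p ^ 2 ∣ W.conductorNorm ℤ) → ((W.conductorNorm ℤ).primeFactors.filter (fun p => p ≠ 2 ∧ ¬ p ^ 2 ∣ W.conductorNorm ℤ)).card ≤ 3 → (¬ ∃ a b c : ℕ, Literature.NumberTheory.DiophantineGeometry.IsABCTriple a b c ∧ (∀ p : ℕ, p.Prime → p ≠ 2 → p ∣ a * b * c → p ∣ W.conductorNorm ℤ) ∧ (∀ p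 ∈ (W.conductorNorm ℤ).primeFactors, ¬ p ^ 2 ∣ W.conductorNorm ℤ → (W.minimalDiscriminantNorm ℤ).factorization p ≤ 2 * (a * b * c).factorization p)) → ∀ p ∈ (W.conductorNorm ℤ).primeFactors.filter (fun p => ¬ p ^ 2 ∣ W.conductorNorm ℤ), ∀ q ∈ (W.conductorNorm ℤ).primeFactors.filter (fun p => ¬ p ^ 2 ∣ W.conductorNorm ℤ), p ≠ q → (((W.minimalDiscriminantNorm ℤ).factorization p * (W.minimalDiscriminantNorm ℤ).factorization q : ℕ) : ℝ) ≤ C * (W.conductorNorm ℤ : ℝ) ^ ε * ((Nat.gcd ((W.minimalDiscriminantNorm ℤ).factorization p) ((W.minimalDiscriminantNorm ℤ).factorization q) ^ 2 : ℕ) : ℝ) := by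
  sorry

/-- **stub 3 — W2: the depth on the shadow-free class** (`FewPrimeDepthResidual`): `gcd_{p ∥ N} c_p ≤ C_ε N^ε` for `W`
semistable away from `2`, `≤ 3` odd multiplicative primes, no numerical Frey shadow, `S ≠ ∅`. Crux-necessary
(`depthResidualNoShadow_of_fewPrimeValuationProduct` below). Semistable sub-case: Mestre–Oesterlé (`G ≤ 5`, named fact);
¬Squarefree sub-case: `stub_depthResidual_of_hasse` (p142354) reduces it to the least distinguishing prime `≪ N^ε`
against ≤ 10 rational newforms of level `∣ 256` (OPEN; GRH: `(log N)²`) — first mechanism `Ideas/level-raising-depth.md`.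
Size: XL–XXL (Linnik/Vinogradov class unconditionally; M conditionally on GRH for the one-odd-prime face). -/
theorem stub_depthResidual :
    ∀ ε : ℝ, 0 < ε → ∃ C : ℝ, ∀ (W : WeierstrassCurve ℚ) [W.IsElliptic], (∀ p : ℕ, p.Prime → p ≠ 2 → ¬ p ^ 2 ∣ W.conductorNorm ℤ) → ((W.conductorNorm ℤ).primeFactors.filter (fun p => p ≠ 2 ∧ ¬ p ^ 2 ∣ W.conductorNorm ℤ)).card ≤ 3 → (¬ ∃ a b c : ℕ, Literature.NumberTheory.DiophantineGeometry.IsABCTriple a b c ∧ (∀ p : ℕ, p.Prime → p ≠ 2 → p ∣ a * b * c → p ∣ W.conductorNorm ℤ) ∧ (∀ p ∈ (W.conductorNorm ℤ).primeFactors, ¬ p ^ 2 ∣ W.conductorNorm ℤ → (W.minimalDiscriminantNorm ℤ).factorization p ≤ 2 * (a * b * c).factorization p)) → ((W.conductorNorm ℤ).primeFactors.filter (fun p => ¬ p ^ 2 ∣ W.conductorNorm ℤ)).Nonempty → ((((W.conductorNorm ℤ).primeFactors.filter (fun p => ¬ p ^ 2 ∣ W.conductorNorm ℤ)).gcd (fun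 p => (W.minimalDiscriminantNorm ℤ).factorization p) : ℕ) : ℝ) ≤ C * (W.conductorNorm ℤ : ℝ) ^ ε := by
  sorry

/-! ## The simplex composition relative to a sub-class (pair half AND depth restricted) -/

/-- **Pair half + depth on a sub-class `P` of the few-prime class ⟹ the valuation-product bound on `P`.**
Both hypotheses carry `H_sf`, `H_card` and `P W`. With `X := ⌈K₁ N^{ε/16}⌉` and `G ≤ K₂ N^{ε/16}` the
simplex bound `switching_simplex_bound` gives `T ≤ X^{12} G^4 ≤ (K₁+1)^{12} K₂^4 N^ε`; `S = ∅` gives `T = 1`.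
(Variant of `switching_valProd_le_of_bounds`, whose pair half is quantified over the whole class.) [folklore] -/
theorem wallSplit_valProd_le_of_bounds (P : WeierstrassCurve ℚ → Prop)
    (hP : ∀ ε : ℝ, 0 < ε → ∃ C : ℝ, ∀ (W : WeierstrassCurve ℚ) [W.IsElliptic],
      (∀ p : ℕ, p.Prime → p ≠ 2 → ¬ p ^ 2 ∣ W.conductorNorm ℤ) →
      ((W.conductorNorm ℤ).primeFactors.filter (fun p => p ≠ 2 ∧ ¬ p ^ 2 ∣ W.conductorNorm ℤ)).card ≤ 3 →
      P W →
      ∀ p ∈ (W.conductorNorm ℤ).primeFactors.filter (fun p => ¬ p ^ 2 ∣ W.conductorNorm ℤ),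
      ∀ q ∈ (W.conductorNorm ℤ).primeFactors.filter (fun p => ¬ p ^ 2 ∣ W.conductorNorm ℤ), p ≠ q →
        (((W.minimalDiscriminantNorm ℤ).factorization p *
            (W.minimalDiscriminantNorm ℤ).factorization q : ℕ) : ℝ) ≤ C * (W.conductorNorm ℤ : ℝ) ^ ε *
          ((Nat.gcd ((W.minimalDiscriminantNorm ℤ).factorization p)
            ((W.minimalDiscriminantNorm ℤ).factorization q) ^ 2 : ℕ) : ℝ))
    (hD : ∀ ε : ℝ, 0 < ε → ∃ C : ℝ, ∀ (W : WeierstrassCurve ℚ) [W.IsElliptic],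
      (∀ p : ℕ, p.Prime → p ≠ 2 → ¬ p ^ 2 ∣ W.conductorNorm ℤ) →
      ((W.conductorNorm ℤ).primeFactors.filter (fun p => p ≠ 2 ∧ ¬ p ^ 2 ∣ W.conductorNorm ℤ)).card ≤ 3 →
      P W → ((W.conductorNorm ℤ).primeFactors.filter (fun p => ¬ p ^ 2 ∣ W.conductorNorm ℤ)).Nonempty →
        ((((W.conductorNorm ℤ).primeFactors.filter (fun p => ¬ p ^ 2 ∣ W.conductorNorm ℤ)).gcd
          (fun p => (W.minimalDiscriminantNorm ℤ).factorization p) : ℕ) : ℝ) ≤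
          C * (W.conductorNorm ℤ : ℝ) ^ ε) :
    ∀ ε : ℝ, 0 < ε → ∃ C : ℝ, ∀ (W : WeierstrassCurve ℚ) [W.IsElliptic],
      (∀ p : ℕ, p.Prime → p ≠ 2 → ¬ p ^ 2 ∣ W.conductorNorm ℤ) →
      ((W.conductorNorm ℤ).primeFactors.filter (fun p => p ≠ 2 ∧ ¬ p ^ 2 ∣ W.conductorNorm ℤ)).card ≤ 3 →
      P W → ((∏ p ∈ (W.conductorNorm ℤ).primeFactors with ¬ p ^ 2 ∣ W.conductorNorm ℤ,
          (W.minimalDiscriminantNorm ℤ).factorization p : ℕ) : ℝ) ≤ C * (W.conductorNorm ℤ : ℝ) ^ ε := by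
  classical
  intro ε hε
  have hε' : 0 < ε / 16 := by positivity
  obtain ⟨C₁, hC₁⟩ := hP (ε / 16) hε'
  obtain ⟨C₂, hC₂⟩ := hD (ε / 16) hε'
  set K₁ : ℝ := max C₁ 0 + 1 with hK₁
  set K₂ : ℝ := max C₂ 1 with hK₂
  have hK₁1 : 1 ≤ K₁ := by have := le_max_right C₁ 0; linarith
  have hK₁C : C₁ ≤ K₁ := by have := le_max_left C₁ 0; linarith
  have hK₂1 : 1 ≤ K₂ := le_max_right _ _
  refine ⟨(K₁ + 1) ^ 12 * K₂ ^ 4, fun W _ hss hcard hPW => ?_⟩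
  set N : ℝ := (W.conductorNorm ℤ : ℝ) with hNdef
  set S : Finset ℕ := (W.conductorNorm ℤ).primeFactors.filter (fun p => ¬ p ^ 2 ∣ W.conductorNorm ℤ)
    with hSdef
  set c : ℕ → ℕ := fun p => (W.minimalDiscriminantNorm ℤ).factorization p with hcdef
  have hN1 : 1 ≤ N := by rw [hNdef]; exact_mod_cast W.conductorNorm_pos_holds
  have hN0 : 0 < N := by linarith
  have hNε' : 1 ≤ N ^ (ε / 16) := Real.one_le_rpow hN1 hε'.le
  have hNε : 1 ≤ N ^ ε := Real.one_le_rpow hN1 hε.le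
  have hconst1 : 1 ≤ (K₁ + 1) ^ 12 * K₂ ^ 4 :=
    one_le_mul_of_one_le_of_one_le (one_le_pow₀ (by linarith)) (one_le_pow₀ hK₂1)
  have hTS : (∏ p ∈ (W.conductorNorm ℤ).primeFactors with ¬ p ^ 2 ∣ W.conductorNorm ℤ,
      (W.minimalDiscriminantNorm ℤ).factorization p) = ∏ p ∈ S, c p := rfl
  rw [hTS]
  by_cases hS : S.Nonempty
  swap
  · rw [Finset.not_nonempty_iff_eq_empty.mp hS, Finset.prod_empty, Nat.cast_one]
    exact one_le_mul_of_one_le_of_one_le hconst1 hNε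
  set X : ℕ := ⌈K₁ * N ^ (ε / 16)⌉₊ with hXdef
  have hKN : 1 ≤ K₁ * N ^ (ε / 16) := one_le_mul_of_one_le_of_one_le hK₁1 hNε'
  have hX1 : 1 ≤ X := Nat.one_le_iff_ne_zero.mpr fun h0 => by
    have := Nat.ceil_eq_zero.mp h0; linarith
  have hXle : (X : ℝ) ≤ (K₁ + 1) * N ^ (ε / 16) := by
    have h1 : (X : ℝ) < K₁ * N ^ (ε / 16) + 1 := Nat.ceil_lt_add_one (by linarith)
    nlinarith
  have hpair : ∀ a ∈ S, ∀ b ∈ S, a ≠ b → c a * c b ≤ X * Nat.gcd (c a) (c b) ^ 2 := by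
    intro a ha b hb hab
    have hg0 : (0 : ℝ) ≤ ((Nat.gcd (c a) (c b) ^ 2 : ℕ) : ℝ) := Nat.cast_nonneg _
    have h2 : C₁ * N ^ (ε / 16) ≤ (X : ℝ) :=
      (mul_le_mul_of_nonneg_right hK₁C (by positivity)).trans (Nat.le_ceil _)
    have h3 : ((c a * c b : ℕ) : ℝ) ≤ (X : ℝ) * ((Nat.gcd (c a) (c b) ^ 2 : ℕ) : ℝ) :=
      (hC₁ W hss hcard hPW a ha b hb hab).trans (mul_le_mul_of_nonneg_right h2 hg0)
    exact_mod_cast h3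
  have hsimp := switching_simplex_bound hX1 hS (switching_card_filter_le_four W hcard)
    (fun a ha => Summit.ABC.ABC.Theorems.ManyPrimeValuationProduct.one_le_factorization_of_mem_filter W ha) hpair
  have hG : ((S.gcd c : ℕ) : ℝ) ≤ K₂ * N ^ (ε / 16) :=
    (hC₂ W hss hcard hPW hS).trans (mul_le_mul_of_nonneg_right (le_max_left _ _) (by positivity))
  have hpow : (N ^ (ε / 16)) ^ (16 : ℕ) = N ^ ε := by
    rw [← Real.rpow_natCast, ← Real.rpow_mul hN0.le]; norm_num
  calc ((∏ p ∈ S, c p : ℕ) : ℝ) ≤ ((X ^ 12 * S.gcd c ^ 4 : ℕ) : ℝ) := by exact_mod_cast hsimp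
    _ = (X : ℝ) ^ 12 * ((S.gcd c : ℕ) : ℝ) ^ 4 := by push_cast; ring
    _ ≤ ((K₁ + 1) * N ^ (ε / 16)) ^ 12 * (K₂ * N ^ (ε / 16)) ^ 4 := by gcongr
    _ = (K₁ + 1) ^ 12 * K₂ ^ 4 * (N ^ (ε / 16)) ^ (16 : ℕ) := by ring
    _ = (K₁ + 1) ^ 12 * K₂ ^ 4 * N ^ ε := by rw [hpow]

/-! ## Leaves 2 ∧ 3 ⟹ the residual; the split glue by name -/

/-- **Pair half and depth on the shadow-free class ⟹ the residual `NonFreyResidual`** (the item on the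
curves of its class admitting no numerical Frey shadow): `wallSplit_valProd_le_of_bounds` with
`P W :=` "no abc triple whose odd primes are multiplicative for `W` and whose doubled exponents dominate the
component orders". [folklore] -/
theorem valProd_noShadow_of_pairResidual_of_depthResidual :
    (∀ ε : ℝ, 0 < ε → ∃ C : ℝ, ∀ (W : WeierstrassCurve ℚ) [W.IsElliptic], (∀ p : ℕ, p.Prime → p ≠ 2 → ¬ p ^ 2 ∣ W.conductorNorm ℤ) → ((W.conductorNorm ℤ).primeFactors.filter (fun p => p ≠ 2 ∧ ¬ p ^ 2 ∣ W.conductorNorm ℤ)).card ≤ 3 → (¬ ∃ a b c : ℕ, Literature.NumberTheory.DiophantineGeometry.IsABCTriple a b c ∧ (∀ p : ℕ, p.Prime → p ≠ 2 → p ∣ a * b * c → p ∣ W.conductorNorm ℤ) ∧ (∀ p ∈ (W.conductorNorm ℤ).primeFactors, ¬ p ^ 2 ∣ W.conductorNorm ℤ → (W.minimalDiscriminantNorm ℤ).factorization p ≤ 2 * (a * b * c).factorization p)) → ∀ p ∈ (W.conductorNorm ℤ).primeFactors.filter (fun p => ¬ p ^ 2 ∣ W.conductorNorm ℤ), ∀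 q ∈ (W.conductorNorm ℤ).primeFactors.filter (fun p => ¬ p ^ 2 ∣ W.conductorNorm ℤ), p ≠ q → (((W.minimalDiscriminantNorm ℤ).factorization p * (W.minimalDiscriminantNorm ℤ).factorization q : ℕ) : ℝ) ≤ C * (W.conductorNorm ℤ : ℝ) ^ ε * ((Nat.gcd ((W.minimalDiscriminantNorm ℤ).factorization p) ((W.minimalDiscriminantNorm ℤ).factorization q) ^ 2 : ℕ) : ℝ)) →
    (∀ ε : ℝ, 0 < ε → ∃ C : ℝ, ∀ (W : WeierstrassCurve ℚ) [W.IsElliptic], (∀ p : ℕ, p.Prime → p ≠ 2 → ¬ p ^ 2 ∣ W.conductorNorm ℤ) → ((W.conductorNorm ℤ).primeFactors.filter (fun p => p ≠ 2 ∧ ¬ p ^ 2 ∣ W.conductorNorm ℤ)).card ≤ 3 → (¬ ∃ a b c : ℕ, Literature.NumberTheory.DiophantineGeometry.IsABCTriple a b c ∧ (∀ p : ℕ, p.Prime → p ≠ 2 → p ∣ a * b * c → p ∣ W.conductorNorm ℤ) ∧ (∀ p ∈ (W.conductorNorm ℤ).primeFactors, ¬ p ^ 2 ∣ W.conductorNorm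 ℤ → (W.minimalDiscriminantNorm ℤ).factorization p ≤ 2 * (a * b * c).factorization p)) → ((W.conductorNorm ℤ).primeFactors.filter (fun p => ¬ p ^ 2 ∣ W.conductorNorm ℤ)).Nonempty → ((((W.conductorNorm ℤ).primeFactors.filter (fun p => ¬ p ^ 2 ∣ W.conductorNorm ℤ)).gcd (fun p => (W.minimalDiscriminantNorm ℤ).factorization p) : ℕ) : ℝ) ≤ C * (W.conductorNorm ℤ : ℝ) ^ ε) →
    ∀ ε : ℝ, 0 < ε → ∃ C : ℝ, ∀ (W : WeierstrassCurve ℚ) [W.IsElliptic], (∀ p : ℕ, p.Prime → p ≠ 2 → ¬ p ^ 2 ∣ W.conductorNorm ℤ) → ((W.conductorNorm ℤ).primeFactors.filter (fun p => p ≠ 2 ∧ ¬ p ^ 2 ∣ W.conductorNorm ℤ)).card ≤ 3 → (¬ ∃ a b c : ℕ, Literature.NumberTheory.DiophantineGeometry.IsABCTriple a b c ∧ (∀ p : ℕ, p.Prime → p ≠ 2 → p ∣ a * b * c → p ∣ W.conductorNorm ℤ) ∧ (∀ p ∈ (W.conductorNorm ℤ).primeFactors, ¬ p ^ 2 ∣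 W.conductorNorm ℤ → (W.minimalDiscriminantNorm ℤ).factorization p ≤ 2 * (a * b * c).factorization p)) → ((∏ p ∈ (W.conductorNorm ℤ).primeFactors with ¬ p ^ 2 ∣ W.conductorNorm ℤ, (W.minimalDiscriminantNorm ℤ).factorization p : ℕ) : ℝ) ≤ C * (W.conductorNorm ℤ : ℝ) ^ ε :=
  fun hP hD => wallSplit_valProd_le_of_bounds
    (fun W => ¬ ∃ a b c : ℕ, Literature.NumberTheory.DiophantineGeometry.IsABCTriple a b c ∧
      (∀ p : ℕ, p.Prime → p ≠ 2 → p ∣ a * b * c → p ∣ W.conductorNorm ℤ) ∧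
      (∀ p ∈ (W.conductorNorm ℤ).primeFactors, ¬ p ^ 2 ∣ W.conductorNorm ℤ →
        (W.minimalDiscriminantNorm ℤ).factorization p ≤ 2 * (a * b * c).factorization p)) hP hD

/-- **The composition from the three stub STATEMENTS (sorry-free; by name).** Sub-exponential abc on four-prime triples (leaf 1) ∧ the pair half on the
shadow-free class (leaf 2) ∧ the depth on the shadow-free class (leaf 3) ⟹ the item
`Summit.ABC.ABC.Theses.RibetTakahashiSplit.FewPrimeValuationProduct`: leaf 1 gives the Frey part
(`freyFewPrime_of_subexpFour`), leaves 2 ∧ 3 give the residual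
(`valProd_noShadow_of_pairResidual_of_depthResidual`), and the numerical Frey dictionary
`crux_of_frey_of_residual` (`T(W) ≤ 16 ∏ v_p(abc)`, `rad ≤ 2N` on a shadow) assembles them. The three
hypotheses are the children of the route split of stmt-ABC-1563 (one per wall W3 / W1 / W2); all are open.
[folklore] -/
theorem FewPrimeValuationProduct_of_stubs :
    (∀ ε : ℝ, 0 < ε → ∃ κ : ℝ, ∀ a b c : ℕ, Literature.NumberTheory.DiophantineGeometry.IsABCTriple a b c → (a * b * c).primeFactors.card ≤ 4 → Real.log c ≤ κ * (Literature.NumberTheory.DiophantineGeometry.rad a b c : ℝ) ^ ε) →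
    (∀ ε : ℝ, 0 < ε → ∃ C : ℝ, ∀ (W : WeierstrassCurve ℚ) [W.IsElliptic], (∀ p : ℕ, p.Prime → p ≠ 2 → ¬ p ^ 2 ∣ W.conductorNorm ℤ) → ((W.conductorNorm ℤ).primeFactors.filter (fun p => p ≠ 2 ∧ ¬ p ^ 2 ∣ W.conductorNorm ℤ)).card ≤ 3 → (¬ ∃ a b c : ℕ, Literature.NumberTheory.DiophantineGeometry.IsABCTriple a b c ∧ (∀ p : ℕ, p.Prime → p ≠ 2 → p ∣ a * b * c → p ∣ W.conductorNorm ℤ) ∧ (∀ p ∈ (W.conductorNorm ℤ).primeFactors, ¬ p ^ 2 ∣ W.conductorNorm ℤ → (W.minimalDiscriminantNorm ℤ).factorization p ≤ 2 * (a * b * c).factorization p)) → ∀ p ∈ (W.conductorNorm ℤ).primeFactors.filter (fun p => ¬ p ^ 2 ∣ W.conductorNorm ℤ), ∀ q ∈ (W.conductorNorm ℤ).primeFactors.filter (fun p => ¬ p ^ 2 ∣ W.conductorNorm ℤ), p ≠ q → (((W.minimalDiscriminantNorm ℤ).factorization p * (W.minimalDiscriminantNorm ℤ).factorization q : ℕ)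 : ℝ) ≤ C * (W.conductorNorm ℤ : ℝ) ^ ε * ((Nat.gcd ((W.minimalDiscriminantNorm ℤ).factorization p) ((W.minimalDiscriminantNorm ℤ).factorization q) ^ 2 : ℕ) : ℝ)) →
    (∀ ε : ℝ, 0 < ε → ∃ C : ℝ, ∀ (W : WeierstrassCurve ℚ) [W.IsElliptic], (∀ p : ℕ, p.Prime → p ≠ 2 → ¬ p ^ 2 ∣ W.conductorNorm ℤ) → ((W.conductorNorm ℤ).primeFactors.filter (fun p => p ≠ 2 ∧ ¬ p ^ 2 ∣ W.conductorNorm ℤ)).card ≤ 3 → (¬ ∃ a b c : ℕ, Literature.NumberTheory.DiophantineGeometry.IsABCTriple a b c ∧ (∀ p : ℕ, p.Prime → p ≠ 2 → p ∣ a * b * c → p ∣ W.conductorNorm ℤ) ∧ (∀ p ∈ (W.conductorNorm ℤ).primeFactors, ¬ p ^ 2 ∣ W.conductorNorm ℤ → (W.minimalDiscriminantNorm ℤ).factorization p ≤ 2 * (a * b * c).factorization p)) → ((W.conductorNorm ℤ).primeFactors.filter (fun p => ¬ p ^ 2 ∣ W.conductorNorm ℤ)).Nonempty → ((((W.conductorNorm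 ℤ).primeFactors.filter (fun p => ¬ p ^ 2 ∣ W.conductorNorm ℤ)).gcd (fun p => (W.minimalDiscriminantNorm ℤ).factorization p) : ℕ) : ℝ) ≤ C * (W.conductorNorm ℤ : ℝ) ^ ε) →
    Summit.ABC.ABC.Theses.RibetTakahashiSplit.FewPrimeValuationProduct :=
  fun hS hP hD => crux_of_frey_of_residual (freyFewPrime_of_subexpFour hS)
    (valProd_noShadow_of_pairResidual_of_depthResidual hP hD)

/-! ## Necessity: the item implies each leaf (the split is an equivalence) -/

/-- Two distinct factors of a product of naturals `≥ 1` multiply to at most the product. [folklore] -/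
theorem wallSplit_mul_le_prod {S : Finset ℕ} {f : ℕ → ℕ} (hf : ∀ r ∈ S, 1 ≤ f r) {p q : ℕ}
    (hp : p ∈ S) (hq : q ∈ S) (hpq : p ≠ q) : f p * f q ≤ ∏ r ∈ S, f r := by
  classical
  rw [← Finset.mul_prod_erase S f hp]
  refine Nat.mul_le_mul_left _ ?_
  have hq' : q ∈ S.erase p := Finset.mem_erase.mpr ⟨hpq.symm, hq⟩
  exact Finset.single_le_prod' (fun r hr => hf r (Finset.mem_of_mem_erase hr)) hq'

/-- **The item implies leaf 2** (the pair half on the shadow-free class): `c_p c_q ≤ T(W) ≤ C N^ε` (all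
`c_r ≥ 1`) and `gcd ≥ 1`; the shadow-freeness hypothesis is simply dropped. [folklore] -/
theorem pairResidual_of_fewPrimeValuationProduct :
    Summit.ABC.ABC.Theses.RibetTakahashiSplit.FewPrimeValuationProduct →
    ∀ ε : ℝ, 0 < ε → ∃ C : ℝ, ∀ (W : WeierstrassCurve ℚ) [W.IsElliptic], (∀ p : ℕ, p.Prime → p ≠ 2 → ¬ p ^ 2 ∣ W.conductorNorm ℤ) → ((W.conductorNorm ℤ).primeFactors.filter (fun p => p ≠ 2 ∧ ¬ p ^ 2 ∣ W.conductorNorm ℤ)).card ≤ 3 → (¬ ∃ a b c : ℕ, Literature.NumberTheory.DiophantineGeometry.IsABCTriple a b c ∧ (∀ p : ℕ, p.Prime → p ≠ 2 → p ∣ a * b * c → p ∣ W.conductorNorm ℤ) ∧ (∀ p ∈ (W.conductorNorm ℤ).primeFactors, ¬ p ^ 2 ∣ W.conductorNorm ℤ → (W.minimalDiscriminantNorm ℤ).factorization p ≤ 2 * (a * b * c).factorization p)) → ∀ p ∈ (W.conductorNorm ℤ).primeFactors.filter (fun p => ¬ p ^ 2 ∣ W.conductorNorm ℤ), ∀ q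 ∈ (W.conductorNorm ℤ).primeFactors.filter (fun p => ¬ p ^ 2 ∣ W.conductorNorm ℤ), p ≠ q → (((W.minimalDiscriminantNorm ℤ).factorization p * (W.minimalDiscriminantNorm ℤ).factorization q : ℕ) : ℝ) ≤ C * (W.conductorNorm ℤ : ℝ) ^ ε * ((Nat.gcd ((W.minimalDiscriminantNorm ℤ).factorization p) ((W.minimalDiscriminantNorm ℤ).factorization q) ^ 2 : ℕ) : ℝ) := by
  intro hcrux ε hε
  obtain ⟨C, hC⟩ := hcrux ε hε
  refine ⟨max C 0, fun W _ hss hcard _ p hp q hq hpq => ?_⟩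
  set S := (W.conductorNorm ℤ).primeFactors.filter (fun p => ¬ p ^ 2 ∣ W.conductorNorm ℤ) with hS
  set c : ℕ → ℕ := fun r => (W.minimalDiscriminantNorm ℤ).factorization r with hc
  have hT := hC W hss hcard
  have hN0 : (0 : ℝ) ≤ (W.conductorNorm ℤ : ℝ) := Nat.cast_nonneg _
  have hNε : 0 ≤ (W.conductorNorm ℤ : ℝ) ^ ε := Real.rpow_nonneg hN0 ε
  have hone : ∀ r ∈ S, 1 ≤ c r := fun r hr =>
    Summit.ABC.ABC.Theorems.ManyPrimeValuationProduct.one_le_factorization_of_mem_filter W hr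
  have hmul : c p * c q ≤ ∏ r ∈ S, c r := wallSplit_mul_le_prod hone hp hq hpq
  have hmulR : ((c p * c q : ℕ) : ℝ) ≤ ((∏ r ∈ S, c r : ℕ) : ℝ) := by exact_mod_cast hmul
  have hg1 : 1 ≤ Nat.gcd (c p) (c q) := Nat.gcd_pos_of_pos_left _ (hone p hp)
  have hg1R : (1 : ℝ) ≤ ((Nat.gcd (c p) (c q) ^ 2 : ℕ) : ℝ) := by
    exact_mod_cast Nat.one_le_pow _ _ hg1
  have hmax : C * (W.conductorNorm ℤ : ℝ) ^ ε ≤ max C 0 * (W.conductorNorm ℤ : ℝ) ^ ε :=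
    mul_le_mul_of_nonneg_right (le_max_left _ _) hNε
  have hK0 : 0 ≤ max C 0 * (W.conductorNorm ℤ : ℝ) ^ ε := mul_nonneg (le_max_right _ _) hNε
  calc ((c p * c q : ℕ) : ℝ) ≤ ((∏ r ∈ S, c r : ℕ) : ℝ) := hmulR
    _ ≤ C * (W.conductorNorm ℤ : ℝ) ^ ε := hT
    _ ≤ max C 0 * (W.conductorNorm ℤ : ℝ) ^ ε := hmax
    _ = max C 0 * (W.conductorNorm ℤ : ℝ) ^ ε * 1 := (mul_one _).symm
    _ ≤ max C 0 * (W.conductorNorm ℤ : ℝ) ^ ε * ((Nat.gcd (c p) (c q) ^ 2 : ℕ) : ℝ) :=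
        mul_le_mul_of_nonneg_left hg1R hK0

/-- **The item implies leaf 3** (the depth on the shadow-free class): for a multiplicative prime `r`,
`G(W) ∣ c_r`, `c_r ≥ 1`, so `G(W) ≤ c_r ≤ T(W) ≤ C N^ε`. [folklore] -/
theorem depthResidualNoShadow_of_fewPrimeValuationProduct :
    Summit.ABC.ABC.Theses.RibetTakahashiSplit.FewPrimeValuationProduct →
    ∀ ε : ℝ, 0 < ε → ∃ C : ℝ, ∀ (W : WeierstrassCurve ℚ) [W.IsElliptic], (∀ p : ℕ, p.Prime → p ≠ 2 → ¬ p ^ 2 ∣ W.conductorNorm ℤ) → ((W.conductorNorm ℤ).primeFactors.filter (fun p => p ≠ 2 ∧ ¬ p ^ 2 ∣ W.conductorNorm ℤ)).card ≤ 3 → (¬ ∃ a b c : ℕ, Literature.NumberTheory.DiophantineGeometry.IsABCTriple a b c ∧ (∀ p : ℕ, p.Prime → p ≠ 2 → p ∣ a * b * c → p ∣ W.conductorNorm ℤ) ∧ (∀ p ∈ (W.conductorNorm ℤ).primeFactors, ¬ p ^ 2 ∣ W.conductorNorm ℤ → (W.minimalDiscriminantNorm ℤ).factorization p ≤ 2 *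 (a * b * c).factorization p)) → ((W.conductorNorm ℤ).primeFactors.filter (fun p => ¬ p ^ 2 ∣ W.conductorNorm ℤ)).Nonempty → ((((W.conductorNorm ℤ).primeFactors.filter (fun p => ¬ p ^ 2 ∣ W.conductorNorm ℤ)).gcd (fun p => (W.minimalDiscriminantNorm ℤ).factorization p) : ℕ) : ℝ) ≤ C * (W.conductorNorm ℤ : ℝ) ^ ε := by
  intro hcrux ε hε
  obtain ⟨C, hC⟩ := hcrux ε hε
  refine ⟨max C 0, fun W _ hss hcard _ hne => ?_⟩
  set S := (W.conductorNorm ℤ).primeFactors.filter (fun p => ¬ p ^ 2 ∣ W.conductorNorm ℤ) with hS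
  set c : ℕ → ℕ := fun r => (W.minimalDiscriminantNorm ℤ).factorization r with hc
  have hT := hC W hss hcard
  have hN0 : (0 : ℝ) ≤ (W.conductorNorm ℤ : ℝ) := Nat.cast_nonneg _
  have hNε : 0 ≤ (W.conductorNorm ℤ : ℝ) ^ ε := Real.rpow_nonneg hN0 ε
  have hone : ∀ r ∈ S, 1 ≤ c r := fun r hr =>
    Summit.ABC.ABC.Theorems.ManyPrimeValuationProduct.one_le_factorization_of_mem_filter W hr
  obtain ⟨r, hr⟩ := hne
  have hGr : S.gcd c ≤ c r := Nat.le_of_dvd (hone r hr) (Finset.gcd_dvd hr)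
  have hrT : c r ≤ ∏ s ∈ S, c s := Finset.single_le_prod' hone hr
  have hle : ((S.gcd c : ℕ) : ℝ) ≤ ((∏ s ∈ S, c s : ℕ) : ℝ) := by exact_mod_cast hGr.trans hrT
  have hmax : C * (W.conductorNorm ℤ : ℝ) ^ ε ≤ max C 0 * (W.conductorNorm ℤ : ℝ) ^ ε :=
    mul_le_mul_of_nonneg_right (le_max_left _ _) hNε
  exact hle.trans (hT.trans hmax)

/-- **The wall split is an equivalence.** `FewPrimeValuationProduct ⟺ SubexpAbcFourPrimes ∧
FewPrimePairHalfResidual ∧ FewPrimeDepthResidual` — the item is exactly: sub-exponential abc on the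
triples with at most four prime factors (W3), the pair half (W1) and the depth (W2) on the curves of the class
without a numerical Frey shadow. All three conjuncts are open. [folklore] -/
theorem fewPrimeValuationProduct_iff_stubs :
    Summit.ABC.ABC.Theses.RibetTakahashiSplit.FewPrimeValuationProduct ↔
    ((∀ ε : ℝ, 0 < ε → ∃ κ : ℝ, ∀ a b c : ℕ, Literature.NumberTheory.DiophantineGeometry.IsABCTriple a b c → (a * b * c).primeFactors.card ≤ 4 → Real.log c ≤ κ * (Literature.NumberTheory.DiophantineGeometry.rad a b c : ℝ) ^ ε) ∧
    (∀ ε : ℝ, 0 < ε → ∃ C : ℝ, ∀ (W : WeierstrassCurve ℚ) [W.IsElliptic], (∀ p : ℕ, p.Prime → p ≠ 2 → ¬ p ^ 2 ∣ W.conductorNorm ℤ) → ((W.conductorNorm ℤ).primeFactors.filter (fun p => p ≠ 2 ∧ ¬ p ^ 2 ∣ W.conductorNorm ℤ)).card ≤ 3 → (¬ ∃ a b c : ℕ, Literature.NumberTheory.DiophantineGeometry.IsABCTriple a b c ∧ (∀ p : ℕ, p.Prime → p ≠ 2 → p ∣ a * b * c → p ∣ W.conductorNorm ℤ) ∧ (∀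 p ∈ (W.conductorNorm ℤ).primeFactors, ¬ p ^ 2 ∣ W.conductorNorm ℤ → (W.minimalDiscriminantNorm ℤ).factorization p ≤ 2 * (a * b * c).factorization p)) → ∀ p ∈ (W.conductorNorm ℤ).primeFactors.filter (fun p => ¬ p ^ 2 ∣ W.conductorNorm ℤ), ∀ q ∈ (W.conductorNorm ℤ).primeFactors.filter (fun p => ¬ p ^ 2 ∣ W.conductorNorm ℤ), p ≠ q → (((W.minimalDiscriminantNorm ℤ).factorization p * (W.minimalDiscriminantNorm ℤ).factorization q : ℕ) : ℝ) ≤ C * (W.conductorNorm ℤ : ℝ) ^ ε * ((Nat.gcd ((W.minimalDiscriminantNorm ℤ).factorization p) ((W.minimalDiscriminantNorm ℤ).factorization q) ^ 2 : ℕ) : ℝ)) ∧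
    (∀ ε : ℝ, 0 < ε → ∃ C : ℝ, ∀ (W : WeierstrassCurve ℚ) [W.IsElliptic], (∀ p : ℕ, p.Prime → p ≠ 2 → ¬ p ^ 2 ∣ W.conductorNorm ℤ) → ((W.conductorNorm ℤ).primeFactors.filter (fun p => p ≠ 2 ∧ ¬ p ^ 2 ∣ W.conductorNorm ℤ)).card ≤ 3 → (¬ ∃ a b c : ℕ, Literature.NumberTheory.DiophantineGeometry.IsABCTriple a b c ∧ (∀ p : ℕ, p.Prime → p ≠ 2 → p ∣ a * b * c → p ∣ W.conductorNorm ℤ) ∧ (∀ p ∈ (W.conductorNorm ℤ).primeFactors, ¬ p ^ 2 ∣ W.conductorNorm ℤ → (W.minimalDiscriminantNorm ℤ).factorization p ≤ 2 * (a * b * c).factorization p)) → ((W.conductorNorm ℤ).primeFactors.filter (fun p => ¬ p ^ 2 ∣ W.conductorNorm ℤ)).Nonempty → ((((W.conductorNorm ℤ).primeFactors.filter (fun p => ¬ p ^ 2 ∣ W.conductorNorm ℤ)).gcd (fun p => (W.minimalDiscriminantNorm ℤ).factorization p) : ℕ) : ℝ) ≤ C * (W.conductorNorm ℤ : ℝ)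 ^ ε)) :=
  ⟨fun h => ⟨subexpFour_of_fewPrimeValuationProduct h, pairResidual_of_fewPrimeValuationProduct h,
      depthResidualNoShadow_of_fewPrimeValuationProduct h⟩,
    fun h => FewPrimeValuationProduct_of_stubs h.1 h.2.1 h.2.2⟩


/-! ## Skeleton theorem -/

/-- **Skeleton theorem**: the crux `Summit.ABC.ABC.Theses.RibetTakahashiSplit.FewPrimeValuationProduct` BY NAME from the
three registered stubs (`FewPrimeValuationProduct_of_stubs`). [folklore] -/
theorem FewPrimeValuationProduct_of :
    Summit.ABC.ABC.Theses.RibetTakahashiSplit.FewPrimeValuationProduct :=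
  FewPrimeValuationProduct_of_stubs stub_subexpAbcFourPrimes stub_pairHalfResidual stub_depthResidual

end Summit.ABC.ABC.Cruxes.FewPrimeValuationProduct.WallSplit

end
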